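import Summits.Ventures.QEC.Census.BB.BB144.OrbitBZCover
import Summits.Ventures.QEC.Census.BB.BB144.BZAutData
import HarnessLib

/-!
# `[[144,12,12]]`, `bz_aut` certificate `7c1e929a`, side Z: the LABEL COVER WITH AUTOMORPHISMS holds — KERNEL

C5 of BZ-CHECKER-SPEC for the 15-block Brouwer–Zimmermann certificate with automorphisms
(`BB144.bzAutData`, qec-search-7, `Census/BB/BB144/BZAutData.lean`): every one of the 4095 non-zero logical
labels `λ ∈ 𝔽₂¹²` lies in the label span `W_b` of one of the 15 certified blocks, directly or after one of the 72
translations of `ℤ₁₂ × ℤ₆` — checked by type-12's TABULATED word-level replay `coverAutTabOK`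
(`Census/BB/BB144/OrbitBZCover.lean`: the 12 columns of each label-action matrix `ρ_t` are computed once per
translation from `LX`, `LZ` and `BB.translateIdx`; each probe is a XOR of ≤ 12 twelve-bit words), by
`decide +kernel` in ≈ 50 s farm wall (axioms: `propext` only).  No cover witness table and no `ρ` data are read:
the automorphisms enter as the bare list of group elements `(t₁, t₂)`.

USE (10.BZC closer, `stmt-Ventures-19772` NoZLogicalBelowTwelve): `coverAutTabOK_hcover coverAutTabOK_bb144 hW hLd hL`
is the `hcover` hypothesis of `BB.forall_lt_of_bzAut_translateFlat` / `BB.d_eq_of_bzAut_translateFlat_even`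
(type-07 `BZAutBBFlat.lean`) and of type-10's `bzAut_lower_sound` (`CertCheckBZAutSound.lean`, with
`hW := testBit_coverMask_imp_exists_span …`), for `A := {t : Mono 12 6 // (t₁,t₂) ∈ allTranslations}`.
HONEST FRAMING: this is ONE conjunct (the cover) of the lower-bound certificate; the block enumerations
(`BZAutEnumZ*`), structure and bounds are separate files; no distance value is asserted here.  Tier KERNEL.
-/

namespace Summit.Ventures.QEC.Census.BB144

/-- All 72 translations of `ℤ₁₂ × ℤ₆` as pairs `(t₁, t₂)`, `t₁ < 12`, `t₂ < 6` (the identity `(0,0)` included —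
harmless for the cover). (definition) -/
def allTranslations : List (ℕ × ℕ) :=
  (List.range 12).flatMap fun a => (List.range 6).map fun b => (a, b)

/-- **C5 (bz_aut) for `BB144`, KERNEL**: the tabulated label cover of the 15-block certificate under the 72
translations checks (`decide +kernel`, ≈ 50 s). -/
theorem coverAutTabOK_bb144 :
    coverAutTabOK 12 6 bzAutData.LX bzAutData.LZ allTranslations bzAutData.sideZ.blocks = true := by
  decide +kernel

end Summit.Ventures.QEC.Census.BB144
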